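import Summits.MatrixMultiplication.OmegaCensus.SmallFormats.KroneckerDual

/-!
# Kronecker modules V: a minimal dual chain splits off an `L_ε` summand

Cell `pub-omega` (unit `pub-omega-tensor-g33`), topic `Summits/MatrixMultiplication/OmegaCensus` (sub-folder `SmallFormats`).
Framing (verbatim): lottery ticket; floor = certified bounds/negative ranges. HONEST FRAMING: general linear algebra toward
PROVING `KroneckerBlockForm97`; nothing on `ω` here.

**Theorem (`dual_peel`).** If `ψ` is a MINIMAL nonzero chain of length `ε` of the module `(bᵀ, aᵀ) : V* → U*`, then the
module `a b : U →ₗ[k] V` splits as `L_ε ⊕ (U₂, V₂)`: `U = U₁ ⊕ U₂`, `V = V₁ ⊕ V₂`, both pairs `a,b`-invariant,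
`finrank U₁ = ε`, `finrank V₁ = ε + 1`, with vectors `u₀,…,u_{ε-1} ∈ U₁`, `v₀,…,v_ε ∈ V₁` (linearly independent) and
`a uᵢ = vᵢ`, `b uᵢ = v_{i+1}`. Proof: `KroneckerPeel.peel` in the dual module, then coannihilators
(`IsCompl.dualCoannihilator`) and dual bases (an injective map between spaces of equal dimension is surjective).
-/

namespace Summit.MatrixMultiplication.OmegaCensus.SmallFormats.Kronecker

open Module Submodule

variable {k : Type*} [Field k] {U V : Type*} [AddCommGroup U] [Module k U] [AddCommGroup V] [Module k V]

/-! ## Coannihilators of complements -/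

/-- A vector killed by the generators of a span is killed by the span. -/
theorem mem_dualCoannihilator_span_range {ι : Type*} (ψ : ι → Dual k V) {v : V} (h : ∀ i, ψ i v = 0) :
    v ∈ (span k (Set.range ψ)).dualCoannihilator := by
  rw [Submodule.mem_dualCoannihilator]
  intro φ hφ
  induction hφ using Submodule.span_induction with
  | mem _ h' => obtain ⟨i, rfl⟩ := h'; exact h i
  | zero => simp
  | add _ _ _ _ h1 h2 => simp [h1, h2]
  | smul c _ _ h1 => simp [h1]

variable [FiniteDimensional k V]

/-- Dimension of a coannihilator. -/
theorem finrank_dualCoannihilator_add (P : Submodule k (Dual k V)) :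
    finrank k P.dualCoannihilator + finrank k P = finrank k V := by
  rw [Subspace.finrank_dualCoannihilator_eq, add_comm, Subspace.finrank_add_finrank_dualAnnihilator_eq,
    Subspace.dual_finrank_eq]

/-- **Complements dualize to complements**: if `P ⊕ Q = V*` then `P° ⊕ Q° = V` (coannihilators). -/
theorem IsCompl.dualCoannihilator {P Q : Submodule k (Dual k V)} (h : IsCompl P Q) :
    IsCompl P.dualCoannihilator Q.dualCoannihilator := by
  have hinf : P.dualCoannihilator ⊓ Q.dualCoannihilator = ⊥ := by
    rw [← Submodule.dualCoannihilator_sup_eq, codisjoint_iff.mp h.codisjoint, Submodule.dualCoannihilator_top]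
  refine ⟨disjoint_iff.mpr hinf, codisjoint_iff.mpr (Submodule.eq_top_of_finrank_eq ?_)⟩
  have h1 := Submodule.finrank_sup_add_finrank_inf_eq P.dualCoannihilator Q.dualCoannihilator
  rw [hinf, finrank_bot, add_zero] at h1
  have h2 := finrank_dualCoannihilator_add P
  have h3 := finrank_dualCoannihilator_add Q
  have h4 := Submodule.finrank_add_eq_of_isCompl h
  rw [Subspace.dual_finrank_eq] at h4
  omega

/-! ## Dual bases inside a coannihilator -/

/-- **Dual vectors.** If `V₁ ⊓ (span ψ)° = ⊥` and `finrank V₁ = n` for `ψ : Fin n → V*`, then there are `v_j ∈ V₁` with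
`ψ_s (v_j) = δ_{sj}`, and a vector of `V₁` is determined by its values under the `ψ_s`. -/
theorem exists_dual_vectors {n : ℕ} (ψ : Fin n → Dual k V) (V₁ : Submodule k V)
    (hdisj : ∀ v ∈ V₁, (∀ s, ψ s v = 0) → v = 0) (hdim : finrank k V₁ = n) :
    (∃ v : Fin n → V, (∀ j, v j ∈ V₁) ∧ ∀ s j, ψ s (v j) = if s = j then 1 else 0) ∧
      ∀ v ∈ V₁, ∀ v' ∈ V₁, (∀ s, ψ s v = ψ s v') → v = v' := by
  let Θ : V₁ →ₗ[k] (Fin n → k) := LinearMap.pi fun s => (ψ s).comp V₁.subtype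
  have hΘ : ∀ (v : V₁) s, Θ v s = ψ s v := fun v s => rfl
  have hinj : Function.Injective Θ := by
    rw [← LinearMap.ker_eq_bot, LinearMap.ker_eq_bot']
    intro v hv
    have := hdisj v v.2 (fun s => by rw [← hΘ, hv]; rfl)
    exact Subtype.ext this
  have hsurj : Function.Surjective Θ :=
    (LinearMap.injective_iff_surjective_of_finrank_eq_finrank (by rw [hdim, Module.finrank_fin_fun])).mp hinj
  refine ⟨?_, fun v hv v' hv' h => ?_⟩
  · choose w hw using fun j => hsurj (Pi.single j 1)
    refine ⟨fun j => (w j : V), fun j => (w j).2, fun s j => ?_⟩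
    rw [← hΘ, hw, Pi.single_apply]
  · have := hinj (a₁ := ⟨v, hv⟩) (a₂ := ⟨v', hv'⟩) (funext fun s => by rw [hΘ, hΘ]; exact h s)
    exact congrArg Subtype.val this

omit [FiniteDimensional k V] in
/-- Vectors with `δ`-coordinates are linearly independent. -/
theorem linearIndependent_of_dual_delta {n : ℕ} (ψ : Fin n → Dual k V) (v : Fin n → V)
    (hδ : ∀ s j, ψ s (v j) = if s = j then 1 else 0) : LinearIndependent k v := by
  classical
  rw [Fintype.linearIndependent_iff]
  intro d hd s
  have h := congrArg (ψ s) hd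
  rw [map_sum, map_zero] at h
  simp only [map_smul, hδ, smul_eq_mul, mul_ite, mul_one, mul_zero, Finset.sum_ite_eq, Finset.mem_univ, if_true] at h
  exact h

variable [FiniteDimensional k U]
variable {a b : U →ₗ[k] V}

/-- **Dual peeling theorem.** A minimal nonzero chain `ψ` of length `ε` of the dual module `(bᵀ, aᵀ)` splits the module
`(a, b)` as an `L_ε` block `(U₁, V₁)` plus an invariant complement `(U₂, V₂)`, with an explicit block basis
`a uᵢ = vᵢ`, `b uᵢ = v_{i+1}` (`i < ε`). -/
theorem dual_peel {ε : ℕ} {ψ : ℕ → Dual k V} (hψ : IsChain b.dualMap a.dualMap ε ψ) (hψ0 : ψ ≠ 0)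
    (hmin : MinimalAt b.dualMap a.dualMap ε) :
    ∃ (U₁ U₂ : Submodule k U) (V₁ V₂ : Submodule k V), IsCompl U₁ U₂ ∧ IsCompl V₁ V₂ ∧
      (∀ u ∈ U₁, a u ∈ V₁) ∧ (∀ u ∈ U₁, b u ∈ V₁) ∧ (∀ u ∈ U₂, a u ∈ V₂) ∧ (∀ u ∈ U₂, b u ∈ V₂) ∧
      finrank k U₁ = ε ∧ finrank k V₁ = ε + 1 ∧
      ∃ (u : Fin ε → U) (v : Fin (ε + 1) → V), (∀ i, u i ∈ U₁) ∧ (∀ j, v j ∈ V₁) ∧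
        LinearIndependent k u ∧ LinearIndependent k v ∧
        (∀ i : Fin ε, a (u i) = v (Fin.castSucc i)) ∧ (∀ i : Fin ε, b (u i) = v (Fin.succ i)) := by
  classical
  obtain ⟨A', B', hA'1, hA'2, hcV, hcU⟩ := peel hψ hψ0 hmin
  -- P = ⟨ψ_t⟩ ≤ V*, Q = ⟨ψ_t ∘ a⟩ ≤ U*
  set P := span k (Set.range fun t : Fin (ε + 1) => ψ t) with hP
  set Q := span k (Set.range fun t : Fin ε => a.dualMap (ψ t)) with hQ
  have hPi := linearIndependent_chain hψ hψ0 hmin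
  have hQi := linearIndependent_b_chain hψ hψ0 hmin
  have hPd : finrank k P = ε + 1 := by rw [hP, finrank_span_eq_card hPi, Fintype.card_fin]
  have hQd : finrank k Q = ε := by rw [hQ, finrank_span_eq_card hQi, Fintype.card_fin]
  refine ⟨B'.dualCoannihilator, Q.dualCoannihilator, A'.dualCoannihilator, P.dualCoannihilator,
    (IsCompl.dualCoannihilator hcU).symm, (IsCompl.dualCoannihilator hcV).symm, ?_, ?_, ?_, ?_, ?_, ?_, ?_⟩
  · -- a U₁ ⊆ V₁
    intro u hu
    rw [Submodule.mem_dualCoannihilator] at hu ⊢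
    intro φ hφ
    exact hu _ (hA'2 φ hφ)
  · -- b U₁ ⊆ V₁
    intro u hu
    rw [Submodule.mem_dualCoannihilator] at hu ⊢
    intro φ hφ
    exact hu _ (hA'1 φ hφ)
  · -- a U₂ ⊆ V₂
    intro u hu
    rw [Submodule.mem_dualCoannihilator] at hu
    refine mem_dualCoannihilator_span_range _ fun s => ?_
    rcases Fin.eq_castSucc_or_eq_last s with ⟨t, rfl⟩ | rfl
    · have := hu (a.dualMap (ψ t)) (subset_span ⟨t, rfl⟩)
      simpa using this
    · have := hψ.b_last
      simpa using congrArg (fun g : Dual k U => g u) this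
  · -- b U₂ ⊆ V₂
    intro u hu
    rw [Submodule.mem_dualCoannihilator] at hu
    refine mem_dualCoannihilator_span_range _ fun s => ?_
    rcases Fin.eq_zero_or_eq_succ s with rfl | ⟨t, rfl⟩
    · simpa using congrArg (fun g : Dual k U => g u) hψ.head
    · have hrel := congrArg (fun g : Dual k U => g u) (hψ.rel t)
      simp only [LinearMap.dualMap_apply, Fin.val_succ] at hrel ⊢
      rw [hrel]
      have := hu (a.dualMap (ψ t)) (subset_span ⟨t, rfl⟩)
      simpa using this
  · have := finrank_dualCoannihilator_add (k := k) B'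
    have h2 := Submodule.finrank_add_eq_of_isCompl hcU
    rw [hQd, Subspace.dual_finrank_eq] at h2
    omega
  · have := finrank_dualCoannihilator_add (k := k) A'
    have h2 := Submodule.finrank_add_eq_of_isCompl hcV
    rw [hPd, Subspace.dual_finrank_eq] at h2
    omega
  · -- the block basis
    have hV1d : finrank k A'.dualCoannihilator = ε + 1 := by
      have := finrank_dualCoannihilator_add (k := k) A'
      have h2 := Submodule.finrank_add_eq_of_isCompl hcV
      rw [hPd, Subspace.dual_finrank_eq] at h2
      omega
    have hU1d : finrank k B'.dualCoannihilator = ε := by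
      have := finrank_dualCoannihilator_add (k := k) B'
      have h2 := Submodule.finrank_add_eq_of_isCompl hcU
      rw [hQd, Subspace.dual_finrank_eq] at h2
      omega
    have hcV' := (IsCompl.dualCoannihilator hcV).symm
    have hcU' := (IsCompl.dualCoannihilator hcU).symm
    -- v_j ∈ V₁ dual to ψ_s
    have hdisjV : ∀ v ∈ A'.dualCoannihilator, (∀ s : Fin (ε + 1), ψ s v = 0) → v = 0 := by
      intro v hv h0
      have hv2 : v ∈ P.dualCoannihilator := mem_dualCoannihilator_span_range _ h0
      have := Submodule.disjoint_def.mp hcV'.disjoint v hv hv2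
      exact this
    obtain ⟨⟨v, hvmem, hvδ⟩, hvinj⟩ := exists_dual_vectors (fun s : Fin (ε + 1) => ψ s) _ hdisjV hV1d
    -- u_i ∈ U₁ dual to ψ_s ∘ a
    have hdisjU : ∀ u ∈ B'.dualCoannihilator, (∀ s : Fin ε, (a.dualMap (ψ s)) u = 0) → u = 0 := by
      intro u hu h0
      have hu2 : u ∈ Q.dualCoannihilator := mem_dualCoannihilator_span_range _ h0
      exact Submodule.disjoint_def.mp hcU'.disjoint u hu hu2
    obtain ⟨⟨u, humem, huδ⟩, -⟩ := exists_dual_vectors (fun s : Fin ε => a.dualMap (ψ s)) _ hdisjU hU1d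
    have haU1 : ∀ i, a (u i) ∈ A'.dualCoannihilator := fun i => by
      rw [Submodule.mem_dualCoannihilator]; intro φ hφ
      exact (Submodule.mem_dualCoannihilator _).mp (humem i) _ (hA'2 φ hφ)
    have hbU1 : ∀ i, b (u i) ∈ A'.dualCoannihilator := fun i => by
      rw [Submodule.mem_dualCoannihilator]; intro φ hφ
      exact (Submodule.mem_dualCoannihilator _).mp (humem i) _ (hA'1 φ hφ)
    refine ⟨u, v, humem, hvmem, linearIndependent_of_dual_delta _ u huδ, linearIndependent_of_dual_delta _ v hvδ,
      fun i => hvinj _ (haU1 i) _ (hvmem _) fun s => ?_, fun i => hvinj _ (hbU1 i) _ (hvmem _) fun s => ?_⟩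
    · -- ψ_s (a u_i) = δ_{s,i}
      rw [hvδ]
      rcases Fin.eq_castSucc_or_eq_last s with ⟨t, rfl⟩ | rfl
      · have := huδ t i
        simp only [LinearMap.dualMap_apply] at this
        simp only [Fin.val_castSucc]
        rw [this]
        simp [Fin.castSucc_inj]
      · have h := congrArg (fun g : Dual k U => g (u i)) hψ.b_last
        simp only [LinearMap.dualMap_apply, LinearMap.zero_apply] at h
        simp only [Fin.val_last]
        rw [h, if_neg (Fin.castSucc_lt_last i).ne']
    · -- ψ_s (b u_i) = δ_{s,i+1}
      rw [hvδ]
      rcases Fin.eq_zero_or_eq_succ s with rfl | ⟨t, rfl⟩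
      · have h := congrArg (fun g : Dual k U => g (u i)) hψ.head
        simp only [LinearMap.dualMap_apply, LinearMap.zero_apply] at h
        simp only [Fin.val_zero]
        rw [h, if_neg (Fin.succ_ne_zero i).symm]
      · have hrel := congrArg (fun g : Dual k U => g (u i)) (hψ.rel t)
        simp only [LinearMap.dualMap_apply, Fin.val_succ] at hrel ⊢
        rw [hrel]
        have := huδ t i
        simp only [LinearMap.dualMap_apply] at this
        rw [this]
        simp [Fin.ext_iff]

end Summit.MatrixMultiplication.OmegaCensus.SmallFormats.Kronecker
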